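import Mathlib
import Summits.ValiantsHypothesis.ValiantsHypothesis.Theorems.NewtonUnitEquationsNewtonTauWeakFixedK3k16Lines

/-!
# `NewtonTauWeak` (stmt-ValiantsHypothesis-5904), stub `fixedKCoincidence_t2_K3`: line structure WITHOUT
# empty lines

Support file (siege k16).  Variant of `k16_exists_lines` for an exponent list with at least one nonzero
exponent: no dummy direction is needed, `s ≤ N`, and EVERY line is inhabited by a nonzero exponent
(`k16_exists_lines_inhabited`).  Inhabited lines are what lets the global no-short-relation hypothesis (stated through
exponents `d_{j₃} ≠ 0`) exclude every on-ray escape of the local analysis. [folklore]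
-/

set_option linter.dupNamespace false

noncomputable section

open scoped BigOperators

namespace Summit.ValiantsHypothesis.ValiantsHypothesis.Theorems.NewtonTauWeakFixedK3k16

/-- **Line structure with inhabited lines** (siege k16). [folklore] -/
theorem k16_exists_lines_inhabited (N : ℕ) (d : Fin N → Fin 2 →₀ ℕ) (hex : ∃ j, d j ≠ 0) :
    ∃ (s : ℕ) (ep : Fin s → Fin 2 → ℤ) (cls : Fin N → Fin s) (mult : Fin N → ℕ),
      s ≤ N ∧ (∀ i k, 0 ≤ ep i k) ∧ (∀ i, ep i ≠ 0) ∧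
      (∀ i i', ep i 0 * ep i' 1 = ep i 1 * ep i' 0 → i = i') ∧
      (∀ j, d j ≠ 0 → 1 ≤ mult j ∧ ∀ k, ((d j k : ℕ) : ℤ) = (mult j : ℤ) * ep (cls j) k) ∧
      (∀ i, ∃ j, d j ≠ 0 ∧ cls j = i) := by
  classical
  obtain ⟨j₀, hj₀⟩ := hex
  set g : Fin N → ℕ := fun j => Nat.gcd (d j 0) (d j 1) with hg
  set prim : Fin N → Fin 2 → ℕ := fun j k => d j k / g j with hprim
  have hgpos : ∀ j, d j ≠ 0 → 0 < g j := by
    intro j hj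
    by_contra h0
    have h0' : g j = 0 := by omega
    obtain ⟨h00, h01⟩ := Nat.gcd_eq_zero_iff.mp h0'
    apply hj; ext k; fin_cases k
    · exact h00
    · exact h01
  have hdecomp : ∀ j k, d j k = g j * prim j k := fun j k => by
    simp only [hprim]
    rw [Nat.mul_div_cancel']
    fin_cases k
    · exact Nat.gcd_dvd_left _ _
    · exact Nat.gcd_dvd_right _ _
  have hprim_ne : ∀ j, d j ≠ 0 → prim j ≠ 0 := by
    intro j hj h0
    apply hj; ext k
    rw [hdecomp j k, show prim j k = 0 from congr_fun h0 k, mul_zero]; rfl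
  have hcop : ∀ j, d j ≠ 0 → Nat.Coprime (prim j 0) (prim j 1) := fun j hj =>
    Nat.coprime_div_gcd_div_gcd (hgpos j hj)
  set Lns : Finset (Fin 2 → ℕ) := (Finset.univ.filter fun j => d j ≠ 0).image prim with hLns
  have hmem : ∀ j, d j ≠ 0 → prim j ∈ Lns := fun j hj =>
    Finset.mem_image_of_mem prim (Finset.mem_filter.mpr ⟨Finset.mem_univ j, hj⟩)
  have hLmem : ∀ x ∈ Lns, ∃ j, d j ≠ 0 ∧ prim j = x := by
    intro x hx
    obtain ⟨j, hj, rfl⟩ := Finset.mem_image.mp hx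
    exact ⟨j, (Finset.mem_filter.mp hj).2, rfl⟩
  set eqv := Lns.equivFin with heqv
  let ep : Fin Lns.card → Fin 2 → ℤ := fun i k => (((eqv.symm i).val k : ℕ) : ℤ)
  let cls : Fin N → Fin Lns.card := fun j =>
    if h : d j ≠ 0 then eqv ⟨prim j, hmem j h⟩ else eqv ⟨prim j₀, hmem j₀ hj₀⟩
  have heps : ∀ i k, ep i k = (((eqv.symm i).val k : ℕ) : ℤ) := fun i k => rfl
  have hreal : ∀ i : Fin Lns.card, ∃ j, d j ≠ 0 ∧ prim j = (eqv.symm i).val := fun i =>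
    hLmem _ (eqv.symm i).property
  refine ⟨Lns.card, ep, cls, g, ?_, ?_, ?_, ?_, ?_, ?_⟩
  · calc Lns.card ≤ (Finset.univ.filter fun j => d j ≠ 0).card := Finset.card_image_le
      _ ≤ (Finset.univ : Finset (Fin N)).card := Finset.card_filter_le _ _
      _ = N := by simp
  · intro i k; rw [heps]; positivity
  · intro i h
    obtain ⟨j, hj, hpj⟩ := hreal i
    apply hprim_ne j hj
    ext k
    have := congr_fun h k
    rw [heps, ← hpj] at this
    simp only [Pi.zero_apply] at this ⊢
    exact_mod_cast this
  · intro i i' h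
    obtain ⟨j, hj, hpj⟩ := hreal i
    obtain ⟨j', hj', hpj'⟩ := hreal i'
    rw [heps, heps, heps, heps, ← hpj, ← hpj'] at h
    have h' : prim j 0 * prim j' 1 = prim j 1 * prim j' 0 := by exact_mod_cast h
    obtain ⟨h0, h1⟩ := eq_of_parallel_coprime _ _ _ _ (hcop j hj) (hcop j' hj') h'
    have hpp : prim j = prim j' := by ext k; fin_cases k <;> assumption
    have : eqv.symm i = eqv.symm i' := Subtype.ext (by rw [← hpj, ← hpj', hpp])
    exact eqv.symm.injective this
  · intro j hj
    refine ⟨hgpos j hj, fun k => ?_⟩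
    simp only [cls, dif_pos hj, heps, Equiv.symm_apply_apply]
    rw [hdecomp j k]; push_cast; rfl
  · intro i
    obtain ⟨j, hj, hpj⟩ := hreal i
    refine ⟨j, hj, ?_⟩
    simp only [cls, dif_pos hj]
    have : (⟨prim j, hmem j hj⟩ : {x // x ∈ Lns}) = eqv.symm i := Subtype.ext hpj
    rw [this, Equiv.apply_symm_apply]

end Summit.ValiantsHypothesis.ValiantsHypothesis.Theorems.NewtonTauWeakFixedK3k16

end
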